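import Literature.ComputerArithmetic.FloatingPoint.MiniFloat

/-!
# Which magnitudes a minifloat format represents

HONEST FRAMING (venture CertifiedArithmetic / cell `pub-lowprec`): certified error envelopes and
provably optimal rounding/accumulation schemes for low-precision formats under stated cost models;
every table by two implementations; no hardware or vendor claims.

For a format `φ` (file `MiniFloat.lean`) this file decides and characterizes the set of finite
magnitudes (in quanta): `Format.Representable φ n ↔ n ≤ maxScaled ∧ n = k · 2^j, k < 2^(m+1)`
(`MiniFloat.representable_iff`) — the working form of "a floating-point number is a `p`-bit integer
times a power of the radix" [Higham2002ASNA, §2.1, eq. (2.1)–(2.2)] — together with the inverse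
map `MiniFloat.ofScaled` (magnitude ↦ exponent code and trailing significand, via the structural
binade search `Format.shift`) used by the rounding functions of `Round.lean`.

Placement: this file is the venture's own development (not a quotation of a published statement),
hence it lives under `Summits/Ventures/CertifiedArithmetic/`; its declarations extend the Literature
structures `Format` / `MiniFloat` by dot notation and therefore carry their absolute
`Literature.ComputerArithmetic.FloatingPoint.…` names (CONVENTIONS §2).
-/

namespace Literature.ComputerArithmetic.FloatingPoint

namespace MiniFloat

variable {φ : Format}

/-! ### Which magnitudes are representable -/

/-- `n` quanta is the magnitude of some finite datum of `φ`. [folklore] -/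
def _root_.Literature.ComputerArithmetic.FloatingPoint.Format.Representable (φ : Format) (n : ℕ) :
    Prop :=
  ∃ x : MiniFloat φ, x.scaledMag = n

/-- `expOf n` is a valid exponent code when `emaxCode ≥ 1` or `n < 2^m`. [folklore] -/
theorem expOf_le {n : ℕ} (hn : n ≤ φ.maxScaled) : φ.expOf n ≤ φ.emaxCode := by
  unfold Format.expOf
  split
  · exact Nat.zero_le _
  · rename_i hge
    have h1 : 1 ≤ φ.emaxCode := by
      by_contra h0
      have := Format.maxScaled_eq_topMan (φ := φ) (by omega)
      have := φ.topMan_lt; omega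
    have := Format.shift_le (φ := φ) n; omega

/-- For `n ≤ maxScaled` with `2^m ≤ n`: `n < 2^(m + 1 + shift n)`. [folklore] -/
theorem lt_pow_shift_of_le_maxScaled {n : ℕ} (hn : n ≤ φ.maxScaled) (hge : 2 ^ φ.manBits ≤ n) :
    n < 2 ^ (φ.manBits + 1 + φ.shift n) := by
  rcases Nat.lt_or_ge (φ.shift n) (φ.emaxCode - 1) with h | h
  · exact Format.lt_pow_shift h
  · have hs : φ.shift n = φ.emaxCode - 1 := le_antisymm (Format.shift_le n) h
    have h1 : 1 ≤ φ.emaxCode := by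
      by_contra h0
      have := Format.maxScaled_eq_topMan (φ := φ) (by omega)
      have := φ.topMan_lt; omega
    have := Format.maxScaled_lt_pow (φ := φ) h1
    calc n ≤ φ.maxScaled := hn
      _ < 2 ^ (φ.manBits + φ.emaxCode) := this
      _ = 2 ^ (φ.manBits + 1 + φ.shift n) := by rw [hs]; congr 1; omega

/-- `manOf n < 2^m` for `n ≤ maxScaled`. [folklore] -/
theorem manOf_lt {n : ℕ} (hn : n ≤ φ.maxScaled) : φ.manOf n < 2 ^ φ.manBits := by
  unfold Format.manOf
  split
  · assumption
  · rename_i hge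
    have hge' : 2 ^ φ.manBits ≤ n := not_lt.mp hge
    have hlt := lt_pow_shift_of_le_maxScaled hn hge'
    have h1 : n / 2 ^ φ.shift n < 2 ^ φ.manBits * 2 := by
      rw [Nat.div_lt_iff_lt_mul (by positivity)]
      calc n < 2 ^ (φ.manBits + 1 + φ.shift n) := hlt
        _ = 2 ^ φ.manBits * 2 * 2 ^ φ.shift n := by rw [pow_add, pow_succ]
    have h2 := Nat.two_pow_pos φ.manBits
    omega

/-- In the top binade `manOf n ≤ topMan` for `n ≤ maxScaled`. [folklore] -/
theorem manOf_le_top {n : ℕ} (hn : n ≤ φ.maxScaled) (hE : φ.expOf n = φ.emaxCode) :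
    φ.manOf n ≤ φ.topMan := by
  unfold Format.expOf at hE
  unfold Format.manOf
  split
  · rename_i hlt
    rw [if_pos hlt] at hE
    have := Format.maxScaled_eq_topMan (φ := φ) hE.symm
    omega
  · rename_i hge
    rw [if_neg hge] at hE
    -- shift n = emaxCode - 1, and n ≤ (2^m + topMan) 2^(emaxCode-1)
    have hs : φ.shift n = φ.emaxCode - 1 := by omega
    have hmax : n / 2 ^ φ.shift n ≤ 2 ^ φ.manBits + φ.topMan := by
      rw [hs]
      apply Nat.div_le_of_le_mul
      unfold Format.maxScaled Format.scaled at hn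
      rw [if_neg (by omega)] at hn
      rw [mul_comm]; exact hn
    omega

/-- The datum with sign `neg` and magnitude `n ≤ maxScaled` quanta (for representable `n`; for
other `n` the significand is truncated — see `scaledMag_ofScaled`). [folklore] -/
def ofScaled (φ : Format) (neg : Bool) (n : ℕ) (hn : n ≤ φ.maxScaled) : MiniFloat φ :=
  ⟨neg, φ.expOf n, φ.manOf n, expOf_le hn, manOf_lt hn, manOf_le_top hn⟩

/-- `ofScaled` recovers the magnitude of every `n ≤ maxScaled` of the form `k · 2^j` with
`k < 2^(m+1)`. [folklore] -/
theorem scaledMag_ofScaled {neg : Bool} {n : ℕ} (hn : n ≤ φ.maxScaled) {k j : ℕ}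
    (hk : k < 2 ^ (φ.manBits + 1)) (hnkj : n = k * 2 ^ j) :
    (ofScaled φ neg n hn).scaledMag = n := by
  unfold ofScaled scaledMag Format.scaled Format.expOf Format.manOf
  simp only
  by_cases hsmall : n < 2 ^ φ.manBits
  · simp [hsmall]
  · rw [if_neg (by simp [hsmall]), if_neg hsmall, if_neg hsmall, Nat.add_sub_cancel]
    have hsmall : 2 ^ φ.manBits ≤ n := not_lt.mp hsmall
    have hlow := Format.pow_shift_le (φ := φ) hsmall
    have hup := lt_pow_shift_of_le_maxScaled hn hsmall
    -- 2^(shift n) divides n: from n = k 2^j, k < 2^(m+1), 2^(m + shift n) ≤ n we get shift n ≤ j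
    have hsj : φ.shift n ≤ j := by
      by_contra hlt
      have hlt : j < φ.shift n := not_le.mp hlt
      have h1 : n < 2 ^ (φ.manBits + 1 + j) := by
        rw [hnkj, pow_add]
        exact Nat.mul_lt_mul_of_pos_right hk (by positivity)
      have h2 : 2 ^ (φ.manBits + 1 + j) ≤ 2 ^ (φ.manBits + φ.shift n) :=
        Nat.pow_le_pow_right (by norm_num) (by omega)
      omega
    have hdvd : 2 ^ φ.shift n ∣ n := by
      obtain ⟨c, hc⟩ := Nat.pow_dvd_pow 2 hsj
      refine ⟨c * k, ?_⟩
      conv_lhs => rw [hnkj, hc]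
      ring
    have h2m : 2 ^ φ.manBits ≤ n / 2 ^ φ.shift n := by
      rw [Nat.le_div_iff_mul_le (by positivity), ← pow_add]; exact hlow
    calc (2 ^ φ.manBits + (n / 2 ^ φ.shift n - 2 ^ φ.manBits)) * 2 ^ (φ.shift n + 1 - 1)
        = (n / 2 ^ φ.shift n) * 2 ^ φ.shift n := by
          rw [Nat.add_sub_cancel' h2m]; simp
      _ = n := Nat.div_mul_cancel hdvd

/-- CHARACTERIZATION of the finite magnitudes of a binary format: `n` quanta is representable iff
`n ≤ maxScaled` and `n = k · 2^j` for some `k < 2^(m+1) = 2^p` ("a floating-point number is an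
integer of at most `p` bits times a power of two, within range"). [cite: Higham2002ASNA, §2.1] -/
theorem representable_iff {n : ℕ} :
    φ.Representable n ↔ n ≤ φ.maxScaled ∧ ∃ k j : ℕ, k < 2 ^ (φ.manBits + 1) ∧ n = k * 2 ^ j := by
  constructor
  · rintro ⟨x, rfl⟩
    refine ⟨x.scaledMag_le_maxScaled, ?_⟩
    have hT := x.man_lt
    unfold scaledMag Format.scaled
    split
    · exact ⟨x.man, 0, by rw [pow_succ]; omega, by simp⟩
    · exact ⟨2 ^ φ.manBits + x.man, x.expCode - 1, by rw [pow_succ]; omega, rfl⟩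
  · rintro ⟨hn, k, j, hk, hnkj⟩
    exact ⟨ofScaled φ false n hn, scaledMag_ofScaled hn hk hnkj⟩

/-- Decidable form of representability: `ofScaled` recovers `n`. [folklore] -/
theorem representable_iff_ofScaled {n : ℕ} :
    φ.Representable n ↔ ∃ h : n ≤ φ.maxScaled, (ofScaled φ false n h).scaledMag = n := by
  constructor
  · intro h
    obtain ⟨hn, k, j, hk, hnkj⟩ := representable_iff.mp h
    exact ⟨hn, scaledMag_ofScaled hn hk hnkj⟩
  · rintro ⟨hn, h⟩
    exact ⟨_, h⟩

/-- Representability of a magnitude is decidable (by recomputation through `ofScaled`).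
[folklore] -/
instance instDecidableRepresentable (φ : Format) : DecidablePred φ.Representable :=
  fun _ => decidable_of_iff _ representable_iff_ofScaled.symm

/-- Every datum's magnitude is representable (by itself). [folklore] -/
theorem representable_scaledMag (x : MiniFloat φ) : φ.Representable x.scaledMag := ⟨x, rfl⟩

/-- `maxScaled` is representable (by `top`). [folklore] -/
theorem representable_maxScaled (φ : Format) : φ.Representable φ.maxScaled := ⟨top φ, rfl⟩

/-- Representable magnitudes are downward closed under halving of the significand budget: any
`k · 2^j ≤ maxScaled` with `k < 2^(m+1)` is representable (restatement for users). [folklore] -/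
theorem representable_mul_pow {k j : ℕ} (hk : k < 2 ^ (φ.manBits + 1))
    (hle : k * 2 ^ j ≤ φ.maxScaled) : φ.Representable (k * 2 ^ j) :=
  representable_iff.mpr ⟨hle, k, j, hk, rfl⟩

/-- Small magnitudes `n < 2^(m+1)` within range are representable. [folklore] -/
theorem representable_of_lt_pow {n : ℕ} (hn : n < 2 ^ (φ.manBits + 1)) (hle : n ≤ φ.maxScaled) :
    φ.Representable n := by
  simpa using representable_mul_pow (φ := φ) (j := 0) hn (by simpa using hle)

/-- The value of `ofScaled` at a representable magnitude. [folklore] -/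
theorem toRat_ofScaled {neg : Bool} {n : ℕ} (hn : n ≤ φ.maxScaled) (hr : φ.Representable n) :
    (ofScaled φ neg n hn).toRat = (if neg then -(n : ℚ) else n) * φ.quantum := by
  obtain ⟨_, k, j, hk, hnkj⟩ := representable_iff.mp hr
  have hmag := scaledMag_ofScaled (neg := neg) hn hk hnkj
  unfold toRat toInt
  rw [hmag]
  unfold ofScaled
  cases neg <;> simp

/-- Two data have the same value iff they have the same signed magnitude. [folklore] -/
theorem toRat_eq_toRat_iff {ψ : Format} (x y : MiniFloat ψ) : x.toRat = y.toRat ↔ x.toInt = y.toInt := by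
  unfold toRat
  rw [mul_left_inj' (ne_of_gt ψ.quantum_pos), Int.cast_inj]

end MiniFloat

end Literature.ComputerArithmetic.FloatingPoint
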